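import Literature.Geometry.Symplectic.TaubesFamilyCurvatureIntegral
import Literature.Geometry.Symplectic.TaubesFamilyPointwiseBound
import Literature.Geometry.Kaehler.LocalFormsGlue
import HarnessLib

/-!
# `r`-independent `L²` bounds for Taubes's family: `∫ |β|² ≤ z/(2r)·Vol`, `∫ (1 - |α|²) ≥ -z/r·Vol`

Topic `Literature/Geometry/Symplectic`; combines `TaubesFamilyPointwiseBound` (the maximum
principle: `|ψ|² = |ψ₀|² + |ψ₁|² ≤ |c|² + z` for every solution of `(SW_η)`, `η = P₊F_{A₀} -
(|c|²/4)s`, with `z ≥ 0` independent of `c` and of the solution) with `TaubesFamilyCurvatureIntegral`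
(the integrated `ω`-component `∫_N (|ψ₁|² - |ψ₀|² - |c|²) s ∧ s = 0`) into the first integral
estimates of the large-`r` analysis (Taubes 1994, §3 Step 1, towards Lemma 6; Taubes 1995, §5
Step 2: "the `L²` norms of `∇_Aβ` and of `r^{1/2}·β` are bounded … `β` … wants to be zero").

Pointwise `|ψ₁|² - |ψ₀|² - |c|² ≤ z - 2|ψ₀|²`, so integrating against the volume form `s ∧ s`:
`0 = ∫ (|ψ₁|² - |ψ₀|² - |c|²) ≤ z·Vol - 2 ∫ |ψ₀|²`, i.e.

* `2 ∫_N |ψ₀|² s∧s ≤ z ∫_N s∧s` — in Taubes's scaling `ψ₀ = √r β`: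
  `∫_N |β|² ω∧ω ≤ (z/2r) Vol`, so `β → 0` in `L²` as `r → ∞`;
* `0 ≤ |c|² + z - |ψ₁|²` pointwise and `∫_N (|c|² + z - |ψ₁|²) s∧s ≤ z ∫_N s∧s` — with `ψ₁ = √r α`:
  `∫_N (1 - |α|² + z/r) ω∧ω ≤ (z/r) Vol` with non-negative integrand, so `|α| → 1` in `L¹`
  (both in `exists_LTwo_bounds`);
* **`exists_cutoff_volume_bound`** (Taubes 1994, **Lemma 6**, cutoff form): for every smooth
  `φ : N → [0,1]` supported in `{|ψ₁|² ≤ |c|²/4} = {|α| ≤ 1/2}`, `3|c|² ∫ φ s∧s ≤ 4z ∫ s∧s` — the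
  volume of `{|α| < 1/2}`, tested against cutoffs, is `O(1/r)`.

Supporting material proved here: non-negativity / monotonicity of `∫_N f · v` for the volume form
`v = s ∧ s` with its own orientation (`integral_nonneg_of_sign_mul_apply_nonneg`,
`integral_fun_smul_nonneg`, `integral_fun_smul_mono`), and the **component functions**
`alphaSq = |ψ₁|²`, `betaSq = |ψ₀|²` of a configuration of `𝔰_J` — well defined (`|ψ₁|²` is a
function and `|ψ₀|²` the squared norm of a section of `K⁻¹`, Taubes 1994 §1) and smooth.

PROVED, 0 named facts.

## References

* C. H. Taubes, *The Seiberg–Witten invariants and symplectic forms*, Math. Res. Lett. 1 (1994)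
  809–822, §3 Step 1, Lemma 6 (p. 815–816). [Taubes1994]
* C. H. Taubes, *The Seiberg–Witten and Gromov invariants*, Math. Res. Lett. 2 (1995) 221–238,
  §5 Step 2 (p. 234). [Taubes1995]
* J. M. Lee, *Introduction to Smooth Manifolds*, 2nd ed. (2013), Prop. 16.6. [LeeSmoothManifolds2013]
-/

noncomputable section

open scoped Manifold ContDiff ComplexConjugate Topology
open Set Function Filter Complex MeasureTheory Literature.Geometry.Kaehler Literature.Geometry.GaugeTheory
  Literature.Topology.FourManifolds
open Literature.Geometry.Lorentzian (PseudoRiemannianMetric)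
open Literature.Geometry.Manifold Literature.Geometry.Manifold.DeRhamSignFour Literature.NumberTheory.Transcendental

namespace Literature.Geometry.Symplectic

/-! ### Non-negativity and monotonicity of `∫_N f · v` -/

section Integral

variable {N : Type} [TopologicalSpace N] [T2Space N] [CompactSpace N] [ChartedSpace (EuclideanSpace ℝ (Fin 4)) N]
  [IsManifold (𝓡 4) ∞ N]

/-- **Non-negativity of the integral of a non-negative top form** (Lee 2013, Prop. 16.6(c), the
non-strict half; non-negativity measured by the sign of `sign(o_x(e))·α_x(e)` on the reference frame
of the chart at `x`, as in the tree's `MForm.integral_pos_of_sign_mul_apply_nonneg`; no smoothness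
is needed). [cite: LeeSmoothManifolds2013, Prop. 16.6] -/
theorem integral_nonneg_of_sign_mul_apply_nonneg {o : (x : N) → _root_.Orientation ℝ (TangentSpace (𝓡 4) x) (Fin 4)}
    {α : MForm (𝓡 4) N ℝ 4}
    (h0 : ∀ x : N, 0 ≤ Real.sign (orientationForm o x (modelBasis (EuclideanSpace ℝ (Fin 4)) 4)) *
      (show (EuclideanSpace ℝ (Fin 4)) [⋀^Fin 4]→L[ℝ] ℝ from α x) (modelBasis (EuclideanSpace ℝ (Fin 4)) 4)) :
    0 ≤ α.integral o := by
  classical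
  change 0 ≤ ∑ᶠ i : N, ∫ y in (extChartAt (𝓡 4) i).target,
    chartSign o i y * chartPartitionOfUnity (𝓡 4) N i ((extChartAt (𝓡 4) i).symm y) *
      α.inChart i y (modelBasis (EuclideanSpace ℝ (Fin 4)) 4) ∂(modelBasis (EuclideanSpace ℝ (Fin 4)) 4).addHaar
  refine finsum_nonneg fun i ↦ setIntegral_nonneg (measurableSet_extChartAt_target i) fun y hy ↦ ?_
  have hx : (extChartAt (𝓡 4) i).symm y ∈ (extChartAt (𝓡 4) i).source := (extChartAt (𝓡 4) i).map_target hy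
  have hy' : y = extChartAt (𝓡 4) i ((extChartAt (𝓡 4) i).symm y) := ((extChartAt (𝓡 4) i).right_inv hy).symm
  rw [hy', chartIntegrand_extChartAt hx]
  exact mul_nonneg (mul_nonneg (abs_nonneg _) ((chartPartitionOfUnity (𝓡 4) N).nonneg i _)) (h0 _)

variable {v : MForm (𝓡 4) N ℝ 4} (hv : IsSmoothForm v) (hne : ∀ x, v x ≠ 0)

/-- **`∫_{(N, o_v)} f·v ≥ 0` for `f ≥ 0`**, `o_v` the orientation of the nowhere-zero top form `v`
(on the reference frame, `sign(o_v(e))·(f v)(e) = f·|v(e)|`). [cite: LeeSmoothManifolds2013, Prop. 16.6] -/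
theorem integral_fun_smul_nonneg {f : N → ℝ} (hf : ∀ x, 0 ≤ f x) : 0 ≤ MForm.integral (rayFamily hne) (f • v) := by
  refine integral_nonneg_of_sign_mul_apply_nonneg fun x ↦ ?_
  have hvx := abs_nonneg (v x ⇑(modelBasis (EuclideanSpace ℝ (Fin 4)) 4))
  rw [← real_sign_mul_self, ← sign_orientationForm_rayFamily hne x] at hvx
  have h1 : (show (EuclideanSpace ℝ (Fin 4)) [⋀^Fin 4]→L[ℝ] ℝ from (f • v) x) (modelBasis (EuclideanSpace ℝ (Fin 4)) 4) =
      f x * (show (EuclideanSpace ℝ (Fin 4)) [⋀^Fin 4]→L[ℝ] ℝ from v x) (modelBasis (EuclideanSpace ℝ (Fin 4)) 4) := rfl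
  rw [h1, mul_left_comm]
  exact mul_nonneg (hf x) hvx

omit [T2Space N] [CompactSpace N] [IsManifold (𝓡 4) ∞ N] in
include hv in
/-- `f·v` is a smooth form for smooth `f`. [folklore] -/
theorem isSmoothForm_fun_smul {f : N → ℝ} (hf : ContMDiff (𝓡 4) 𝓘(ℝ, ℝ) ∞ f) : IsSmoothForm (f • v) :=
  fun x ↦ MForm.SmoothAt.fun_smul (hf x) (hv x)

include hv in
/-- **Monotonicity `∫ f·v ≤ ∫ g·v` for smooth `f ≤ g`** (linearity of the integral on smooth forms
and non-negativity). [cite: LeeSmoothManifolds2013, Prop. 16.6] -/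
theorem integral_fun_smul_mono {f g : N → ℝ} (hf : ContMDiff (𝓡 4) 𝓘(ℝ, ℝ) ∞ f) (hg : ContMDiff (𝓡 4) 𝓘(ℝ, ℝ) ∞ g)
    (hle : ∀ x, f x ≤ g x) :
    MForm.integral (rayFamily hne) (f • v) ≤ MForm.integral (rayFamily hne) (g • v) := by
  have h0 := integral_fun_smul_nonneg hne (f := fun x ↦ g x - f x) fun x ↦ sub_nonneg.2 (hle x)
  have heq : ((fun x ↦ g x - f x) • v : MForm (𝓡 4) N ℝ 4) = g • v + (-1 : ℝ) • (f • v) := by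
    funext x
    ext w
    simp
    ring
  rw [heq, MForm.integral_add_holds _ (isContinuousOrientation_rayFamily hv hne) (isSmoothForm_fun_smul hv hg)
    ((isSmoothForm_fun_smul hv hf).smul _), MForm.integral_smul] at h0
  linarith

include hv in
/-- Linearity in the function: `∫ (a·f + b)·v = a ∫ f·v + b ∫ v` for smooth `f` and constants `a`, `b`.
[cite: LeeSmoothManifolds2013, Prop. 16.6] -/
theorem integral_const_mul_add_const_smul {f : N → ℝ} (hf : ContMDiff (𝓡 4) 𝓘(ℝ, ℝ) ∞ f) (a b : ℝ) :
    MForm.integral (rayFamily hne) ((fun x ↦ a * f x + b) • v) =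
      a * MForm.integral (rayFamily hne) (f • v) + b * MForm.integral (rayFamily hne) v := by
  have heq : ((fun x ↦ a * f x + b) • v : MForm (𝓡 4) N ℝ 4) = a • (f • v) + b • v := by
    funext x
    ext w
    simp
    ring
  rw [heq, MForm.integral_add_holds _ (isContinuousOrientation_rayFamily hv hne) ((isSmoothForm_fun_smul hv hf).smul _)
    (hv.smul _), MForm.integral_smul, MForm.integral_smul]

end Integral

/-! ### The component functions `|ψ₁|²`, `|ψ₀|²` of a configuration of `𝔰_J` -/

namespace AlmostComplexStructure.IsCompatibleWith

variable {N : Type} [TopologicalSpace N] [ChartedSpace (EuclideanSpace ℝ (Fin 4)) N]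
  [IsManifold (𝓡 4) ∞ N] {J : AlmostComplexStructure (𝓡 4) ∞ N} {s : MForm (𝓡 4) N ℝ 2}
  (h : J.IsCompatibleWith s) (hs : IsSmoothForm s)
  (hnd : ∀ x (v : TangentSpace (𝓡 4) x), v ≠ 0 → ∃ w : TangentSpace (𝓡 4) x, s x ![v, w] ≠ 0)

/-- **`|ψ₁|²(x)`**, the squared modulus of the component of `ψ` along `u₀` (Taubes's `r|α|²`), read
in the chart `indexAt x` — any chart gives the same value (`alphaSq_eq`). [cite: Taubes1994, §1 (p. 811)] -/
def alphaSq (cfg : (h.canonicalSpincStructure hs hnd).Configuration) (x : N) : ℝ :=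
  Complex.normSq (cfg.plusSpinor ((h.canonicalSpincStructure hs hnd).indexAt x) x 1)

/-- **`|ψ₀|²(x)`**, the squared modulus of the component of `ψ` along `K⁻¹` (Taubes's `r|β|²`), read in
the chart `indexAt x` — any chart gives the same value (`betaSq_eq`). [cite: Taubes1994, §1 (p. 811)] -/
def betaSq (cfg : (h.canonicalSpincStructure hs hnd).Configuration) (x : N) : ℝ :=
  Complex.normSq (cfg.plusSpinor ((h.canonicalSpincStructure hs hnd).indexAt x) x 0)

/-- `|ψ₁|²` may be read in any chart (the `u₀`-component is a function). [cite: Taubes1994, §1 (p. 811)] -/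
theorem alphaSq_eq (cfg : (h.canonicalSpincStructure hs hnd).Configuration) (i : N) {x : N}
    (hx : x ∈ (h.canonicalSpincStructure hs hnd).baseSet i) :
    h.alphaSq hs hnd cfg x = Complex.normSq (cfg.plusSpinor i x 1) := by
  unfold alphaSq SpincStructure.Configuration.plusSpinor
  rw [(h.unitaryAdaptedFrames hs hnd).toFun_inl_one_eq cfg.spinor ⟨hx, (h.canonicalSpincStructure hs hnd).mem_baseSet_indexAt x⟩]

/-- `|ψ₀|²` may be read in any chart (the `K⁻¹`-component changes by the unit scalar `λ_ij`).
[cite: Taubes1994, §1 (p. 811)] -/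
theorem betaSq_eq (cfg : (h.canonicalSpincStructure hs hnd).Configuration) (i : N) {x : N}
    (hx : x ∈ (h.canonicalSpincStructure hs hnd).baseSet i) :
    h.betaSq hs hnd cfg x = Complex.normSq (cfg.plusSpinor i x 0) := by
  have hij : x ∈ (h.canonicalSpincStructure hs hnd).baseSet i ∩
      (h.canonicalSpincStructure hs hnd).baseSet ((h.canonicalSpincStructure hs hnd).indexAt x) :=
    ⟨hx, (h.canonicalSpincStructure hs hnd).mem_baseSet_indexAt x⟩
  have hn : ‖(h.unitaryAdaptedFrames hs hnd).toSpincStructure.detLineBundle.toFun i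
      ((h.canonicalSpincStructure hs hnd).indexAt x) x‖ = 1 :=
    (h.canonicalSpincStructure hs hnd).detLineBundle.norm_toFun i _ x hij
  unfold betaSq SpincStructure.Configuration.plusSpinor
  rw [(h.unitaryAdaptedFrames hs hnd).toFun_inl_zero_eq cfg.spinor hij, map_mul, Complex.normSq_eq_norm_sq,
    Complex.normSq_eq_norm_sq, hn, one_pow, one_mul]

/-- `|ψ₁|² + |ψ₀|² = |ψ|²`. [folklore] -/
theorem alphaSq_add_betaSq [(h.metric hs).HasLeviCivita] (cfg : (h.canonicalSpincStructure hs hnd).Configuration) (x : N) :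
    h.alphaSq hs hnd cfg x + h.betaSq hs hnd cfg x = cfg.spinor.hermNormSq x := by
  rw [SpinorField.hermNormSq_eq_spinorNormSq_plusSpinor cfg ((h.canonicalSpincStructure hs hnd).mem_baseSet_indexAt x),
    spinorNormSq, alphaSq, betaSq, add_comm]

/-- `|ψ₀|² ≥ 0`. [folklore] -/
theorem betaSq_nonneg (cfg : (h.canonicalSpincStructure hs hnd).Configuration) (x : N) : 0 ≤ h.betaSq hs hnd cfg x :=
  Complex.normSq_nonneg _

/-- `|ψ₁|²` is smooth. [folklore] -/
theorem contMDiff_alphaSq (cfg : (h.canonicalSpincStructure hs hnd).Configuration) :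
    ContMDiff (𝓡 4) 𝓘(ℝ, ℝ) ∞ (h.alphaSq hs hnd cfg) := by
  intro x₀
  have hi := (h.canonicalSpincStructure hs hnd).mem_baseSet_indexAt x₀
  have hev : h.alphaSq hs hnd cfg =ᶠ[𝓝 x₀]
      fun x ↦ ‖cfg.spinor.toFun ((h.canonicalSpincStructure hs hnd).indexAt x₀) x (Sum.inl 1)‖ ^ 2 := by
    filter_upwards [((h.canonicalSpincStructure hs hnd).isOpen_baseSet _).mem_nhds hi] with x hx
    rw [h.alphaSq_eq hs hnd cfg _ hx, Complex.normSq_eq_norm_sq]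
    rfl
  refine ContMDiffAt.congr_of_eventuallyEq ?_ hev
  exact (contDiff_norm_sq ℝ (n := ∞)).comp_contMDiffAt
    ((cfg.isSmooth _ (Sum.inl 1)).contMDiffAt (((h.canonicalSpincStructure hs hnd).isOpen_baseSet _).mem_nhds hi))

/-- `|ψ₀|²` is smooth. [folklore] -/
theorem contMDiff_betaSq (cfg : (h.canonicalSpincStructure hs hnd).Configuration) :
    ContMDiff (𝓡 4) 𝓘(ℝ, ℝ) ∞ (h.betaSq hs hnd cfg) := by
  intro x₀
  have hi := (h.canonicalSpincStructure hs hnd).mem_baseSet_indexAt x₀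
  have hev : h.betaSq hs hnd cfg =ᶠ[𝓝 x₀]
      fun x ↦ ‖cfg.spinor.toFun ((h.canonicalSpincStructure hs hnd).indexAt x₀) x (Sum.inl 0)‖ ^ 2 := by
    filter_upwards [((h.canonicalSpincStructure hs hnd).isOpen_baseSet _).mem_nhds hi] with x hx
    rw [h.betaSq_eq hs hnd cfg _ hx, Complex.normSq_eq_norm_sq]
    rfl
  refine ContMDiffAt.congr_of_eventuallyEq ?_ hev
  exact (contDiff_norm_sq ℝ (n := ∞)).comp_contMDiffAt
    ((cfg.isSmooth _ (Sum.inl 0)).contMDiffAt (((h.canonicalSpincStructure hs hnd).isOpen_baseSet _).mem_nhds hi))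

/-! ### The `L²` bounds -/

/-- **`r`-independent `L²` bounds for Taubes's family** (Taubes 1994, §3 Step 1; Taubes 1995, §5
Step 2).  On a closed symplectic `4`-manifold `(N, s)` with compatible `J` there is `z ≥ 0`
(depending on `(N, s, J)` only: the constant of the maximum-principle bound `|ψ|² ≤ |c|² + z`) such
that for every `c ∈ ℂ` and every (smooth) solution `(A, ψ)` of the Seiberg–Witten equations with
perturbation `P₊F_{A₀} - (|c|²/4)·s` (Taubes's family (5.2), `r = |c|²`), with `V = s ∧ s` the
symplectic volume form and `∫ = ∫_{(N, o_V)}`: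
1. `2 ∫ |ψ₀|² V ≤ z ∫ V` — i.e. `∫ |β|² ω∧ω ≤ (z/2r)·Vol` for `ψ₀ = √r β`;
2. `0 ≤ |c|² + z - |ψ₁|²` pointwise and `∫ (|c|² + z - |ψ₁|²) V ≤ z ∫ V` — i.e. the non-negative
   function `1 - |α|² + z/r` (`ψ₁ = √r α`) has `∫ (1 - |α|² + z/r) ω∧ω ≤ (z/r)·Vol`.
Proof: integrate the pointwise `|ψ₁|² - |ψ₀|² - |c|² ≤ z - 2|ψ₀|²` against `V` and use
`∫ (|ψ₁|² - |ψ₀|² - |c|²) V = 0` (the integrated `ω`-component). [cite: Taubes1994, §3 Step 1, Lemma 6 (p. 815–816)] -/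
theorem exists_LTwo_bounds [T2Space N] [CompactSpace N] [(h.metric hs).HasLeviCivita] (hcl : IsClosedForm s) :
    ∃ z : ℝ, 0 ≤ z ∧ ∀ (c : ℂ) (cfg : (h.canonicalSpincStructure hs hnd).Configuration),
      SpincStructure.IsSolution (h.taubesPerturbation hs hnd - h.symplecticPerturbation hs hnd (Complex.normSq c / 4)) cfg →
        2 * MForm.integral (rayFamily (wedge_self_castDeg_apply_ne_zero s hnd))
              (h.betaSq hs hnd cfg • (s.wedge s).castDeg two_add_two_eq_four) ≤
            z * MForm.integral (rayFamily (wedge_self_castDeg_apply_ne_zero s hnd)) ((s.wedge s).castDeg two_add_two_eq_four) ∧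
          (∀ x, 0 ≤ Complex.normSq c + z - h.alphaSq hs hnd cfg x) ∧
          MForm.integral (rayFamily (wedge_self_castDeg_apply_ne_zero s hnd))
              ((fun x ↦ Complex.normSq c + z - h.alphaSq hs hnd cfg x) • (s.wedge s).castDeg two_add_two_eq_four) ≤
            z * MForm.integral (rayFamily (wedge_self_castDeg_apply_ne_zero s hnd)) ((s.wedge s).castDeg two_add_two_eq_four) := by
  obtain ⟨z, hz0, hz⟩ := h.exists_forall_hermNormSq_le_taubes hs hnd
  have hv : IsSmoothForm ((s.wedge s).castDeg two_add_two_eq_four) := (wedge_self_castDeg_mem_closedSmoothForms ⟨hs, hcl⟩).1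
  refine ⟨z, hz0, fun c cfg hsol ↦ ?_⟩
  have hne := wedge_self_castDeg_apply_ne_zero s hnd
  have hpt : ∀ x, h.alphaSq hs hnd cfg x + h.betaSq hs hnd cfg x ≤ Complex.normSq c + z := fun x ↦ by
    rw [h.alphaSq_add_betaSq hs hnd cfg x]
    exact hz c cfg hsol x
  have hα := h.contMDiff_alphaSq hs hnd cfg
  have hβ := h.contMDiff_betaSq hs hnd cfg
  -- the integrated `ω`-component, in terms of `alphaSq`, `betaSq`
  have hI0 : MForm.integral (rayFamily hne)
      ((fun x ↦ h.alphaSq hs hnd cfg x - h.betaSq hs hnd cfg x - Complex.normSq c) • (s.wedge s).castDeg two_add_two_eq_four) = 0 :=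
    h.integral_normSq_sub_smul_wedge_self_eq_zero hs hnd hcl c hsol
  have hf : ContMDiff (𝓡 4) 𝓘(ℝ, ℝ) ∞ fun x ↦ h.alphaSq hs hnd cfg x - h.betaSq hs hnd cfg x - Complex.normSq c :=
    (hα.sub hβ).sub contMDiff_const
  -- (1): integrate `α² - β² - |c|² ≤ z - 2β²`
  have hg : ContMDiff (𝓡 4) 𝓘(ℝ, ℝ) ∞ fun x ↦ (-2) * h.betaSq hs hnd cfg x + z := (contMDiff_const.mul hβ).add contMDiff_const
  have hmono := integral_fun_smul_mono hv hne hf hg fun x ↦ by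
    have := hpt x
    linarith
  rw [hI0, integral_const_mul_add_const_smul hv hne hβ] at hmono
  have h1 : 2 * MForm.integral (rayFamily hne) (h.betaSq hs hnd cfg • (s.wedge s).castDeg two_add_two_eq_four) ≤
      z * MForm.integral (rayFamily hne) ((s.wedge s).castDeg two_add_two_eq_four) := by linarith
  refine ⟨h1, fun x ↦ ?_, ?_⟩
  · -- (2a): `|c|² + z - α² ≥ β² ≥ 0`
    have := hpt x
    have := h.betaSq_nonneg hs hnd cfg x
    linarith
  · -- (2b): `∫ (|c|² + z - α²) V = -∫ (α² - β² - |c|²) V + ∫ (-β² + z) V ≤ z ∫ V`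
    have hβ0 : 0 ≤ MForm.integral (rayFamily hne) (h.betaSq hs hnd cfg • (s.wedge s).castDeg two_add_two_eq_four) :=
      integral_fun_smul_nonneg hne (h.betaSq_nonneg hs hnd cfg)
    have heq : ((fun x ↦ Complex.normSq c + z - h.alphaSq hs hnd cfg x) • (s.wedge s).castDeg two_add_two_eq_four :
        MForm (𝓡 4) N ℝ 4) =
      (-1 : ℝ) • ((fun x ↦ h.alphaSq hs hnd cfg x - h.betaSq hs hnd cfg x - Complex.normSq c) •
          (s.wedge s).castDeg two_add_two_eq_four) +
        (fun x ↦ (-1) * h.betaSq hs hnd cfg x + z) • (s.wedge s).castDeg two_add_two_eq_four := by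
      funext x
      ext w
      simp
      ring
    have hg1 : ContMDiff (𝓡 4) 𝓘(ℝ, ℝ) ∞ fun x ↦ (-1) * h.betaSq hs hnd cfg x + z := (contMDiff_const.mul hβ).add contMDiff_const
    rw [heq, MForm.integral_add_holds _ (isContinuousOrientation_rayFamily hv hne) ((isSmoothForm_fun_smul hv hf).smul (-1 : ℝ))
      (isSmoothForm_fun_smul hv hg1), MForm.integral_smul, hI0, integral_const_mul_add_const_smul hv hne hβ]
    linarith

/-- **Taubes 1994, Lemma 6, in cutoff form: the volume of `{|α| < 1/2}` is `O(1/r)`.**  With `z` as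
above, for every `c`, every solution of the family and every smooth cutoff `φ : N → [0, 1]` supported
in the set where `|ψ₁|² ≤ |c|²/4` (i.e. `|α| ≤ 1/2` for `ψ₁ = √r α`, `r = |c|²`):
`3|c|² ∫ φ V ≤ 4z ∫ V`, i.e. `∫ φ ω∧ω ≤ (4z/3r)·Vol → 0` as `r → ∞` — "zero is the limit as `m` tends
to `∞` of the measure of the set of points in `X` where `|α_m| < 1/2`" (Lemma 6), the measure being
tested against smooth cutoffs.  Proof: on the support `|c|² + z - |ψ₁|² ≥ ¾|c|²`, so
`¾|c|² φ ≤ |c|² + z - |ψ₁|²` pointwise, and integrate. [cite: Taubes1994, §3 Lemma 6 (p. 815)] -/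
theorem exists_cutoff_volume_bound [T2Space N] [CompactSpace N] [(h.metric hs).HasLeviCivita] (hcl : IsClosedForm s) :
    ∃ z : ℝ, 0 ≤ z ∧ ∀ (c : ℂ) (cfg : (h.canonicalSpincStructure hs hnd).Configuration),
      SpincStructure.IsSolution (h.taubesPerturbation hs hnd - h.symplecticPerturbation hs hnd (Complex.normSq c / 4)) cfg →
        ∀ φ : N → ℝ, ContMDiff (𝓡 4) 𝓘(ℝ, ℝ) ∞ φ → (∀ x, 0 ≤ φ x) → (∀ x, φ x ≤ 1) →
          (∀ x, φ x ≠ 0 → 4 * h.alphaSq hs hnd cfg x ≤ Complex.normSq c) →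
            3 * Complex.normSq c * MForm.integral (rayFamily (wedge_self_castDeg_apply_ne_zero s hnd))
                (φ • (s.wedge s).castDeg two_add_two_eq_four) ≤
              4 * z * MForm.integral (rayFamily (wedge_self_castDeg_apply_ne_zero s hnd)) ((s.wedge s).castDeg two_add_two_eq_four) := by
  obtain ⟨z, hz0, hz⟩ := h.exists_LTwo_bounds hs hnd hcl
  have hv : IsSmoothForm ((s.wedge s).castDeg two_add_two_eq_four) := (wedge_self_castDeg_mem_closedSmoothForms ⟨hs, hcl⟩).1
  refine ⟨z, hz0, fun c cfg hsol φ hφ hφ0 hφ1 hsupp ↦ ?_⟩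
  obtain ⟨_, hnn, hint⟩ := hz c cfg hsol
  have hne := wedge_self_castDeg_apply_ne_zero s hnd
  have hα := h.contMDiff_alphaSq hs hnd cfg
  -- pointwise: `¾|c|² φ ≤ |c|² + z - α²`
  have hpt : ∀ x, 3 / 4 * Complex.normSq c * φ x + 0 ≤ Complex.normSq c + z - h.alphaSq hs hnd cfg x := by
    intro x
    by_cases hx : φ x = 0
    · rw [hx, mul_zero, zero_add]
      exact hnn x
    · have h4 := hsupp x hx
      have hb : 3 / 4 * Complex.normSq c ≤ Complex.normSq c + z - h.alphaSq hs hnd cfg x := by linarith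
      have hc0 : 0 ≤ 3 / 4 * Complex.normSq c := by have := Complex.normSq_nonneg c; linarith
      nlinarith [hφ0 x, hφ1 x]
  have hf : ContMDiff (𝓡 4) 𝓘(ℝ, ℝ) ∞ fun x ↦ 3 / 4 * Complex.normSq c * φ x + 0 := (contMDiff_const.mul hφ).add contMDiff_const
  have hg : ContMDiff (𝓡 4) 𝓘(ℝ, ℝ) ∞ fun x ↦ Complex.normSq c + z - h.alphaSq hs hnd cfg x := contMDiff_const.sub hα
  have hmono := integral_fun_smul_mono hv hne hf hg hpt
  rw [integral_const_mul_add_const_smul hv hne hφ] at hmono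
  linarith

end AlmostComplexStructure.IsCompatibleWith

end Literature.Geometry.Symplectic

end
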